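import Summits.CriticalPhenomena.PercolationContinuityZ3.Theorems.PercNearOneGluingNoHeavyLowerTailSahiLatinZeroBottomCoreBridge

/-!
# `NoHeavyLowerTail` (crux stmt-CriticalPhenomena-4575), Sahi programme (prim-master-conj gen 49): **TOP-SLICE DOMINANCE WITH THE SHARP CONSTANT
# `3/2` (prim-ineq-gen-4's `4c₁ ≥ 3c₃`, the lower-step form of (C¼) `4c₂ ≥ 7c₃`) ON THE WHOLE PADDED SINGLE-BRIDGE FAMILY, EVERY DIMENSION**

Support file (`--supports stmt-CriticalPhenomena-4575`; one inductive predicate + proofs, no `sorry`, standard axioms).  Memo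
`run/shared/lean/prim/prim-l12/FROM-prim-master-conj-g49-PEELING-THEOREM.md` (§§2–5).  Nothing here asserts the crux, Kahn's conjecture or (C¼)
in general.

THE MATHEMATICS.  The PADDED SINGLE-BRIDGE FAMILY `IsBridgePad κ P b Q c` is generated from the four CORE instances on `[3]^2`
(`P = {x₀ ≥ t₀}`, `b = Pᶜ`, `Q = {x₁ ≥ t₁}`, `c = Qᶜ`, `t₀,t₁ ∈ {1,2}`) by repeatedly adding a coordinate that is FREE (all four sets become cylinders)
or a PRIMED LITERAL of threshold `1` or `2` on the `P`-side (`P, b ↦ ofSections ∅ ∅ ·` resp. `ofSections ∅ · ·`, `Q, c` cylinders) or on the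
`Q`-side.  In prim-ineq-gen-4's language these are exactly the zero-bottom data `P = ℓ_{I′} ∧ ℓ_{i₀}`, `P′ = ℓ_{I′}` (`b = P′ ∖ P`), `Q = ℓ_{J′} ∧ ℓ_{j₀}`,
`Q′ = ℓ_{J′}` with literal conjunctions `ℓ`, ONE unprimed literal on each side, any thresholds, any number of primed and free coordinates — the
family containing every known extremiser of the top-slice ratio (the pure bridges, ratio exactly `3/2`) and their paddings.
**THEOREM (`three_kappa_top_le_two_kappa_lowerStep_of_isBridgePad`).**  For every member and EVERY up-set `F ⊇ P ∪ Q`: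
   `3 · κ(F, P ∪ b, Q ∪ c) ≤ 2 · κ(ofSections F F F, ofSections P P (P ∪ b), ofSections Q Q (Q ∪ c))`,
i.e. the Latin kernel of the lower-step clothing (cylinder over `F`, lower steps `P ⊆ P′`, `Q ⊆ Q′`) is at least `3/2` times the kernel of its
top sections — top-slice dominance `κ_{n+1} ≥ (3/2)·κ_n(top)` (`…SahiTopSliceDominance`: any uniform positive constant in all dimensions would give
Kahn's conjecture) on this infinite all-dimensional family, with the constant that is attained.  Ingredients: `grid4_of_isBridgePad` (induction:
core instances `…CoreBridge`, pairing lemmas `…Grid`), `psi_nonneg_of_grid4`, the clothing identity `three_kappa_top_le_iff_psi_nonneg`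
(`…ZeroBottomPsi`), and `κ(F,P,Q) = 0` from the independent-pair formula of `…SahiLatinSlack` (`P ⊥ Q` is carried through the induction).
HONEST LABEL: a theorem on a sub-family; (C¼), top-slice dominance in general, `PatternPos d` for `d ≥ 5`, Kahn's conjecture remain OPEN. [this work]
-/

namespace Summit.CriticalPhenomena.PercolationContinuityZ3.Theorems.SahiLatin

open Finset

/-! ## §1  The family -/

/-- **The padded single-bridge family** (core instances on `[3]^2`, closed under free / primed-literal coordinate lifts). [this work] -/
inductive IsBridgePad : ∀ (κ : Type) [Fintype κ] [DecidableEq κ], Finset (Pt κ) → Finset (Pt κ) → Finset (Pt κ) → Finset (Pt κ) → Prop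
  | core22 : IsBridgePad (Fin 2) (lit2 0 2) (univ \ lit2 0 2) (lit2 1 2) (univ \ lit2 1 2)
  | core21 : IsBridgePad (Fin 2) (lit2 0 2) (univ \ lit2 0 2) (lit2 1 1) (univ \ lit2 1 1)
  | core12 : IsBridgePad (Fin 2) (lit2 0 1) (univ \ lit2 0 1) (lit2 1 2) (univ \ lit2 1 2)
  | core11 : IsBridgePad (Fin 2) (lit2 0 1) (univ \ lit2 0 1) (lit2 1 1) (univ \ lit2 1 1)
  | free {κ : Type} [Fintype κ] [DecidableEq κ] {P b Q c : Finset (Pt κ)} :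
      IsBridgePad κ P b Q c → IsBridgePad (Option κ) (ofSections P P P) (ofSections b b b) (ofSections Q Q Q) (ofSections c c c)
  | primeP2 {κ : Type} [Fintype κ] [DecidableEq κ] {P b Q c : Finset (Pt κ)} :
      IsBridgePad κ P b Q c → IsBridgePad (Option κ) (ofSections ∅ ∅ P) (ofSections ∅ ∅ b) (ofSections Q Q Q) (ofSections c c c)
  | primeP1 {κ : Type} [Fintype κ] [DecidableEq κ] {P b Q c : Finset (Pt κ)} :
      IsBridgePad κ P b Q c → IsBridgePad (Option κ) (ofSections ∅ P P) (ofSections ∅ b b) (ofSections Q Q Q) (ofSections c c c)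
  | primeQ2 {κ : Type} [Fintype κ] [DecidableEq κ] {P b Q c : Finset (Pt κ)} :
      IsBridgePad κ P b Q c → IsBridgePad (Option κ) (ofSections P P P) (ofSections b b b) (ofSections ∅ ∅ Q) (ofSections ∅ ∅ c)
  | primeQ1 {κ : Type} [Fintype κ] [DecidableEq κ] {P b Q c : Finset (Pt κ)} :
      IsBridgePad κ P b Q c → IsBridgePad (Option κ) (ofSections P P P) (ofSections b b b) (ofSections ∅ Q Q) (ofSections ∅ c c)

/-! ## §2  The grid invariant on the family -/

/-- **`Grid4` holds on the whole padded single-bridge family** (core by `decide`, lifts by the pairing lemmas). [this work] -/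
theorem grid4_of_isBridgePad {κ : Type} [Fintype κ] [DecidableEq κ] {P b Q c : Finset (Pt κ)} (h : IsBridgePad κ P b Q c) :
    Grid4 P b Q c := by
  induction h with
  | core22 => exact grid4_core11_22
  | core21 => exact grid4_core11_21
  | core12 => exact grid4_core11_12
  | core11 => exact grid4_core11_11
  | free _ ih => exact grid4_free ih
  | primeP2 _ ih => exact grid4_primeP_two ih
  | primeP1 _ ih => exact grid4_primeP_one ih
  | primeQ2 _ ih => exact grid4_primeQ_two ih
  | primeQ1 _ ih => exact grid4_primeQ_one ih

/-! ## §3  Disjointness and independence along the family -/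

section lifts
variable {κ : Type} [Fintype κ] [DecidableEq κ]

/-- `ofSections` preserves disjointness sectionwise. [this work] -/
theorem disjoint_ofSections {s₀ s₁ s₂ t₀ t₁ t₂ : Finset (Pt κ)} (h₀ : Disjoint s₀ t₀) (h₁ : Disjoint s₁ t₁) (h₂ : Disjoint s₂ t₂) :
    Disjoint (ofSections s₀ s₁ s₂) (ofSections t₀ t₁ t₂) := by
  rw [disjoint_left]
  intro x hx hx'
  rw [mem_ofSections_iff, sec_ofSections] at hx hx'
  have key : ∀ l : Fin 3, Disjoint ((![s₀, s₁, s₂] l : Finset (Pt κ))) (![t₀, t₁, t₂] l) := by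
    intro l; fin_cases l
    · exact h₀
    · exact h₁
    · exact h₂
  exact disjoint_left.1 (key (x none)) hx hx'

omit [Fintype κ] in
/-- Restricting an update at `some k` is updating the restriction. [this work] -/
theorem restrict_update_some (x : Pt (Option κ)) (k : κ) (v : Fin 3) :
    (fun j => Function.update x (some k) v (some j)) = Function.update (fun j => x (some j)) k v := by
  funext j
  by_cases h : j = k
  · subst h; simp
  · rw [Function.update_of_ne (by simpa using h), Function.update_of_ne h]

/-- The axis `none` is inessential for a cylinder. [this work] -/
theorem axisInessential_cyl_none (S : Finset (Pt κ)) : AxisInessential (ofSections S S S) none := by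
  intro x v
  rw [mem_ofSections_iff, mem_ofSections_iff, sec_ofSections, sec_ofSections]
  have e : (fun k => Function.update x none v (some k)) = fun k => x (some k) := funext fun k => by simp
  rw [e]
  generalize x none = l; generalize Function.update x none v none = l'
  constructor <;> intro h <;> fin_cases l <;> fin_cases l' <;> simpa using h

/-- An axis `some k` inessential for all three sections is inessential for the glued set. [this work] -/
theorem axisInessential_ofSections_some {s₀ s₁ s₂ : Finset (Pt κ)} {k : κ} (h₀ : AxisInessential s₀ k) (h₁ : AxisInessential s₁ k)
    (h₂ : AxisInessential s₂ k) : AxisInessential (ofSections s₀ s₁ s₂) (some k) := by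
  intro x v
  rw [mem_ofSections_iff, mem_ofSections_iff, sec_ofSections, sec_ofSections, restrict_update_some]
  rw [Function.update_of_ne (Option.some_ne_none k).symm]
  generalize x none = l
  fin_cases l
  · exact h₀ _ _
  · exact h₁ _ _
  · exact h₂ _ _

/-- Independence lifts through a free coordinate. [this work] -/
theorem indep_lift_free {P Q : Finset (Pt κ)} (h : Indep P Q) : Indep (ofSections P P P) (ofSections Q Q Q) := by
  intro i
  cases i with
  | none => exact Or.inl (axisInessential_cyl_none P)
  | some k =>
    rcases h k with hk | hk
    · exact Or.inl (axisInessential_ofSections_some hk hk hk)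
    · exact Or.inr (axisInessential_ofSections_some hk hk hk)

/-- Independence lifts through a literal on the first set (second set a cylinder). [this work] -/
theorem indep_lift_lit {s₀ s₁ P Q : Finset (Pt κ)} (h : Indep P Q) (h₀ : ∀ k, AxisInessential P k → AxisInessential s₀ k)
    (h₁ : ∀ k, AxisInessential P k → AxisInessential s₁ k) : Indep (ofSections s₀ s₁ P) (ofSections Q Q Q) := by
  intro i
  cases i with
  | none => exact Or.inr (axisInessential_cyl_none Q)
  | some k =>
    rcases h k with hk | hk
    · exact Or.inl (axisInessential_ofSections_some (h₀ k hk) (h₁ k hk) hk)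
    · exact Or.inr (axisInessential_ofSections_some hk hk hk)

/-- The invariants carried along the family: `P ∩ b = ∅`, `Q ∩ c = ∅`, `P ⊥ Q`. [this work] -/
theorem invariants_of_isBridgePad {κ : Type} [Fintype κ] [DecidableEq κ] {P b Q c : Finset (Pt κ)} (h : IsBridgePad κ P b Q c) :
    Disjoint P b ∧ Disjoint Q c ∧ Indep P Q := by
  induction h with
  | core22 => exact ⟨disjoint_sdiff, disjoint_sdiff, by unfold Indep AxisInessential; decide⟩
  | core21 => exact ⟨disjoint_sdiff, disjoint_sdiff, by unfold Indep AxisInessential; decide⟩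
  | core12 => exact ⟨disjoint_sdiff, disjoint_sdiff, by unfold Indep AxisInessential; decide⟩
  | core11 => exact ⟨disjoint_sdiff, disjoint_sdiff, by unfold Indep AxisInessential; decide⟩
  | free _ ih =>
    exact ⟨disjoint_ofSections ih.1 ih.1 ih.1, disjoint_ofSections ih.2.1 ih.2.1 ih.2.1, indep_lift_free ih.2.2⟩
  | primeP2 _ ih =>
    exact ⟨disjoint_ofSections (disjoint_empty_left _) (disjoint_empty_left _) ih.1, disjoint_ofSections ih.2.1 ih.2.1 ih.2.1,
      indep_lift_lit ih.2.2 (fun k _ => axisInessential_empty k) (fun k _ => axisInessential_empty k)⟩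
  | primeP1 _ ih =>
    exact ⟨disjoint_ofSections (disjoint_empty_left _) ih.1 ih.1, disjoint_ofSections ih.2.1 ih.2.1 ih.2.1,
      indep_lift_lit ih.2.2 (fun k _ => axisInessential_empty k) (fun k hk => hk)⟩
  | primeQ2 _ ih =>
    exact ⟨disjoint_ofSections ih.1 ih.1 ih.1, disjoint_ofSections (disjoint_empty_left _) (disjoint_empty_left _) ih.2.1,
      (indep_lift_lit ih.2.2.symm (fun k _ => axisInessential_empty k) (fun k _ => axisInessential_empty k)).symm⟩
  | primeQ1 _ ih =>
    exact ⟨disjoint_ofSections ih.1 ih.1 ih.1, disjoint_ofSections (disjoint_empty_left _) ih.2.1 ih.2.1,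
      (indep_lift_lit ih.2.2.symm (fun k _ => axisInessential_empty k) (fun k hk => hk)).symm⟩

end lifts

/-! ## §4  The theorem -/

section main
variable {κ : Type} [Fintype κ] [DecidableEq κ]

/-- `κ(F,P,Q) = 0` for independent `P, Q` and `F ⊇ P ∪ Q` (the ZERO BOTTOM): two vanishing Harris slacks. [this work] -/
theorem kappa_eq_zero_of_indep_of_union_subset {F P Q : Finset (Pt κ)} (h : Indep P Q) (hF : P ∪ Q ⊆ F) : kappa F P Q = 0 := by
  rw [kappa_swap12, kappa_swap23, kappa_eq_of_indep h F, inter_eq_left.2 ((subset_union_left).trans hF),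
    inter_eq_left.2 ((subset_union_right).trans hF), HS_eq_zero_of_indep h, add_zero]

/-- **TOP-SLICE DOMINANCE WITH THE SHARP CONSTANT `3/2` ON THE PADDED SINGLE-BRIDGE FAMILY** (every dimension): for every member
`(P, b, Q, c)` of `IsBridgePad` (with `P′ = P ∪ b`, `Q′ = Q ∪ c`) and every up-set `F ⊇ P ∪ Q`,
`3 · κ(F, P′, Q′) ≤ 2 · κ(ofSections F F F, ofSections P P P′, ofSections Q Q Q′)`. [this work] -/
theorem three_kappa_top_le_two_kappa_lowerStep_of_isBridgePad {P b Q c : Finset (Pt κ)} (h : IsBridgePad κ P b Q c)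
    {F : Finset (Pt κ)} (hF : IsUpperSet (F : Set (Pt κ))) (hPQ : P ∪ Q ⊆ F) :
    3 * kappa F (P ∪ b) (Q ∪ c) ≤ 2 * kappa (ofSections F F F) (ofSections P P (P ∪ b)) (ofSections Q Q (Q ∪ c)) := by
  obtain ⟨hPb, hQc, hI⟩ := invariants_of_isBridgePad h
  have h0 : kappa F P Q = 0 := kappa_eq_zero_of_indep_of_union_subset hI hPQ
  have hb : (P ∪ b) \ P = b := by
    rw [union_sdiff_left, Finset.sdiff_eq_self_iff_disjoint]; exact hPb.symm
  have hc : (Q ∪ c) \ Q = c := by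
    rw [union_sdiff_left, Finset.sdiff_eq_self_iff_disjoint]; exact hQc.symm
  have key := (three_kappa_top_le_iff_psi_nonneg (F := F) (subset_union_left (s₁ := P) (s₂ := b))
    (subset_union_left (s₁ := Q) (s₂ := c)) h0).2
  rw [hb, hc] at key
  exact key (psi_nonneg_of_grid4 (grid4_of_isBridgePad h) hF hPQ)

end main

end Summit.CriticalPhenomena.PercolationContinuityZ3.Theorems.SahiLatin
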